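import Summits.BirchSwinnertonDyer.BirchSwinnertonDyer.Theorems.AlignedTransportAtTwoMainConjectureOfRankZeroBSDAtTwoSelmerLayerMuDoorDescentTowerCert
import Literature.NumberTheory.EllipticCurves.SelmerLayerRestrictionInjectiveProofs
import HarnessLib

/-!
# Route `AlignedTransportAtTwo`, crux C2 `MainConjectureOfRankZeroBSDAtTwo` (stmt-BirchSwinnertonDyer-22298):
# DESCENT RANKS ARE MONOTONE UP A `ℤ_p`-TOWER, AND THE FLOOR OF THE DESCENT DOOR —
# at which layer `ℚ_{j′}` of the cyclotomic `ℤ₂`-tower a `2`-descent can possibly certify `μ₂ = 0`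

HONEST FRAMING (cell `bsd-f1-sign2`, WIDTH-5 attached prover seat `bsd-line-att-p5` gen 45 on line `birth` of the lead
`bsd-line-att-p2`; `--supports` stmt-BirchSwinnertonDyer-22298, closes nothing; BSD is NOT proved by any of this; the crux C2,
its verdict «blocked-on `Rank1Residual.GreenbergMuConjectureIrreducible`» and every registered stub are untouched). THEOREMS ONLY —
no `def`, no instance, no named fact, no `sorry`. PLACEMENT: COROLLARY-OF-TREE (Greenberg LNM 1716 §3 Lemma 3.1 + inflation–restriction = the Literature brick
`SelmerLayerRestrictionInjectiveProofs` of this seat; the lineage's g44 descent currency `…SelmerLayerMuDoorDescent{,Base,TowerCert}`).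

The lineage's road (a) reads stub T per curve as ONE inequality between the orders of two honest `2`-Selmer groups of the
layers `ℚ_j ⊂ ℚ_k` of the cyclotomic `ℤ₂`-tower (`…MuDoorDescent.seedMuZero_iff_exists_descent_rankJump_two`), and the TOWER
road's certificate `…DescentTowerCert.towerGapAtTwo_of_descent_cert` turns a kit `2`-descent count `#Sel^(2)(E/ℚ_{j′}) ≤ 2^d`
into `TowerGapAtTwo W`. This file proves the one structural fact those doors had not recorded — **the `2`-descent ranks can only
GROW up the tower** — and reads off the FLOOR it puts under every door: which pairs `(j, j′)` can fire at all, and what the one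
kit count must return when they do. This is the pre-computation that decides where (at which layer) a `2`-descent is worth a
kit hour (the CENSUS ASK of gen 44); it certifies `μ₂ = 0` for no curve.

* §1 = the Literature brick `Literature/NumberTheory/EllipticCurves/SelmerLayerRestrictionInjectiveProofs.lean` (ANY number field
  `K`, ANY prime `p`, ANY `ℤ_p`-extension `κ`, `E(K)[p] = 0`): `Sel_{p^∞}(E/K_j) ↪ Sel_{p^∞}(E/K_k)` for `j ≤ k` and
  `#Sel_{p^∞}(E/K_j)[p] ≤ #Sel_{p^∞}(E/K_k)[p]` (`WeierstrassCurve.natCard_torsionBy_selmerLayer_mono{,_of_not_dvd_torsionOrder}`).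
* §2 (the cell: `W/ℚ` elliptic without a rational `2`-torsion abscissa, any `ℤ₂`-extension `κ`, `j ≤ k`):
  ★ `natCard_selmerGroup_two_layer_mono` — **`#Sel^(2)(E/ℚ_j) ≤ #Sel^(2)(E/ℚ_k)`** in descent currency
  (`Sel^(2)(E/ℚ_n) = selmerGroup (W.baseChange (κ.layer n)) 2`); `natCard_selmerGroup_two_le_layer` (`#Sel^(2)(E/ℚ) ≤ #Sel^(2)(E/ℚ_k)`),
  `natCard_sha_two_le_layer` (`#Ш(E/ℚ)[2] ≤ #Sel^(2)(E/ℚ_k)` in rank `0`), `natCard_selmerGroup_two_layer_pos`.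
* §3 THE FLOORS in `ker g`-currency (Greenberg's finite local defect `W.KerG κ k`, kept symbolic — the tree holds only its UPPER
  bound by local kernels, Lemma 4.7 is not in the tree): the one-layer door at `k` forces `#Sel^(2)(E/ℚ) · #ker g_k < 2^{2^k}`
  (`#Ш(E/ℚ)[2] · #ker g_k < 2^{2^k}` in rank `0`); the base-pair door at `k` forces `2 · #ker g_k < 2^{2^k}`; the two-layer door at
  `j ≤ k` forces `#ker g_k · 2^{2^j} < 2^{2^k}`.
* §4 ★★ THE FLOOR OF THE TOWER CERTIFICATE (`towerGapAtTwo_of_descent_cert`, hypotheses copied VERBATIM at one cyclotomic `κ`):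
  `descent_cert_floor` — `hlow`/`hup`/`harith` force **`a ≤ d`, `4 · ∏_{ℓ∈P} C_ℓ^{2^{min(j′,e_ℓ)}} < 2^{2^{j′} − 2^j}`, hence `j′ ≥ 2`,
  `(j, j′) ≠ (1, 2)`, and at `j′ = 2`: `j = 0`, `∏ = 1`, `d = a`** (NO `2`-Selmer growth from `ℚ` to `ℚ(ζ₁₆)⁺` and every odd bad
  prime in a `C_ℓ = 1` branch); ★★ `descent_cert_floor_of_shaAn_even` — on a Ш-nontrivial seed (`BSD₂`, `ord₂ #Ш_an ≠ 0`; base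
  paid by `#Ш(E/ℚ)[2] ≥ 4`): **`d ≥ 2`, `j′ ≥ 2`, `2^d · ∏ < 2^{2^{j′} − 1}`; at `j′ = 2` exactly `d = 2 = dim Ш(E/ℚ)[2]` and `∏ = 1`;
  at `j′ = 3` (`ℚ(ζ₃₂)⁺`, degree `8`) `2^d · ∏ < 128`**.

References: R. Greenberg, *Iwasawa theory for elliptic curves*, LNM 1716 (1999), §1 p. 60, §3 Lemma 3.1 (p. 86), Lemmas 3.3–3.5,
§4 [GreenbergLNM1716]; J.-P. Serre, *Galois Cohomology*, I.§2.6 (inflation–restriction) [SerreGaloisCohomology1997]; J. H. Silverman,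
GTM 106, Thm. X.4.2 [SilvermanAEC2009]; L. C. Washington, GTM 83, §13.1 [Washington1997].
-/

set_option linter.dupNamespace false
set_option autoImplicit false

noncomputable section

open scoped Classical AddSubgroup

namespace Summit.BirchSwinnertonDyer.BirchSwinnertonDyer.Theorems.AlignedTransportAtTwoSelmerLayerDescentMonotone

open WeierstrassCurve Literature.NumberTheory.EllipticCurves Literature.NumberTheory.EllipticCurves.Greenberg1999
  Summit.BirchSwinnertonDyer.BirchSwinnertonDyer.Theorems.AlignedTransportAtTwoSelmerLayerMuDoorDescent
  Summit.BirchSwinnertonDyer.BirchSwinnertonDyer.Theorems.AlignedTransportAtTwoSelmerLayerMuDoorDescentBase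
  Summit.BirchSwinnertonDyer.BirchSwinnertonDyer.Theorems.AlignedTransportAtTwoSelmerLayerMuDoorDescentTowerCert
  Summit.BirchSwinnertonDyer.BirchSwinnertonDyer.Theorems.AlignedTransportAtTwoCubicClassNumberParityOfLValue



/-! ## §2 The cell (`ℚ`, `p = 2`, no rational `2`-torsion abscissa): descent ranks are monotone up the tower -/

section Cell

variable (W : WeierstrassCurve ℚ) [W.IsElliptic] [W.IsGloballyMinimal]

omit [W.IsGloballyMinimal] in
/-- ★ **DESCENT RANKS ARE MONOTONE UP THE TOWER: `#Sel^(2)(E/ℚ_j) ≤ #Sel^(2)(E/ℚ_k)` for `j ≤ k`** — for `W/ℚ` elliptic without a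
rational `2`-torsion abscissa and ANY `ℤ₂`-extension `κ` of `ℚ`, where `Sel^(2)(E/ℚ_n) = selmerGroup (W.baseChange (κ.layer n)) 2` is
the `2`-Selmer group of a `2`-descent over the number field `ℚ_n` (the Literature brick `natCard_torsionBy_selmerLayer_mono_of_not_dvd_torsionOrder` at `p = 2`, `2 ∤ #E(ℚ)_tors` from
`ht`, read in g44's descent currency `natCard_selmerGroup_two_layer_eq`). In ranks: `d_j ≤ d_k`. [cite: GreenbergLNM1716, §3 Lemma 3.1 (p. 86)] [cite: SilvermanAEC2009, Thm. X.4.2] -/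
theorem natCard_selmerGroup_two_layer_mono (ht : ∀ x : ℚ, ¬ HasRationalTwoTorsionX W x) (κ : ZpExtension ℚ 2) {j k : ℕ}
    (hjk : j ≤ k) :
    Nat.card ((W.baseChange (κ.layer j)).selmerGroup 2) ≤ Nat.card ((W.baseChange (κ.layer k)).selmerGroup 2) := by
  rw [natCard_selmerGroup_two_layer_eq W ht κ j, natCard_selmerGroup_two_layer_eq W ht κ k]
  have h := W.natCard_torsionBy_selmerLayer_mono_of_not_dvd_torsionOrder κ (not_two_dvd_torsionOrder W ht) hjk
  simpa only [Nat.cast_ofNat] using h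

omit [W.IsGloballyMinimal] in
/-- **`#Sel^(2)(E/ℚ) ≤ #Sel^(2)(E/ℚ_k)`**: the `2`-descent over `ℚ` a seed already has is a floor under every layer count
(layer `0` of `κ` is `ℚ`, g44 `natCard_selmerGroup_two_eq_natCard_torsionBy_selmerLayer_zero`). [cite: SilvermanAEC2009, Thm. X.4.2] -/
theorem natCard_selmerGroup_two_le_layer (ht : ∀ x : ℚ, ¬ HasRationalTwoTorsionX W x) (κ : ZpExtension ℚ 2) (k : ℕ) :
    Nat.card (W.selmerGroup 2) ≤ Nat.card ((W.baseChange (κ.layer k)).selmerGroup 2) := by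
  rw [natCard_selmerGroup_two_eq_natCard_torsionBy_selmerLayer_zero W ht κ, ← natCard_selmerGroup_two_layer_eq W ht κ 0]
  exact natCard_selmerGroup_two_layer_mono W ht κ (Nat.zero_le k)

omit [W.IsGloballyMinimal] in
/-- **`#Ш(E/ℚ)[2] ≤ #Sel^(2)(E/ℚ_k)` in rank `0`** (layer `0` is `Ш(E/ℚ)[2]` when `rank E(ℚ) = 0`, g44
`natCard_torsionBy_selmerLayer_zero_two_eq_natCard_sha`). [cite: SilvermanAEC2009, Thm. X.4.2] [cite: GreenbergLNM1716, §2 pp. 62–63] -/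
theorem natCard_sha_two_le_layer (ht : ∀ x : ℚ, ¬ HasRationalTwoTorsionX W x) (hr : W.mordellWeilRank = 0)
    (κ : ZpExtension ℚ 2) (k : ℕ) :
    Nat.card ((↥W.sha)[(2 : ℤ)]) ≤ Nat.card ((W.baseChange (κ.layer k)).selmerGroup 2) := by
  rw [← natCard_torsionBy_selmerLayer_zero_two_eq_natCard_sha W hr κ, ← natCard_selmerGroup_two_layer_eq W ht κ 0]
  exact natCard_selmerGroup_two_layer_mono W ht κ (Nat.zero_le k)

omit [W.IsGloballyMinimal] in
/-- `#Sel^(2)(E/ℚ_k) ≥ 1` (the `2`-Selmer group of the elliptic curve `E_{ℚ_k}` over the number field `ℚ_k` is finite,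
Silverman X.4.2(b), and contains `0`). [cite: SilvermanAEC2009, Thm. X.4.2(b)] -/
theorem natCard_selmerGroup_two_layer_pos (κ : ZpExtension ℚ 2) (k : ℕ) :
    0 < Nat.card ((W.baseChange (κ.layer k)).selmerGroup 2) := by
  haveI : Finite ((W.baseChange (κ.layer k)).selmerGroup 2) :=
    (W.baseChange (κ.layer k)).finite_selmerGroup_holds (n := 2) two_ne_zero
  exact Nat.card_pos

omit [W.IsGloballyMinimal] in
/-- `#Sel^(2)(E/ℚ) ≥ 1`. [cite: SilvermanAEC2009, Thm. X.4.2(b)] -/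
theorem natCard_selmerGroup_two_pos : 0 < Nat.card (W.selmerGroup 2) := by
  haveI : Finite (W.selmerGroup 2) := W.finite_selmerGroup_holds (n := 2) two_ne_zero
  exact Nat.card_pos

/-! ## §3 The floors of the three doors in `ker g`-currency -/

omit [W.IsGloballyMinimal] in
/-- **Floor of the ONE-LAYER door** (`…MuDoorDescent.seedMuZero_of_descent_oneLayer_two`): if
`#Sel^(2)(E/ℚ_k) · #ker g_k < 2^{2^k}` then already `#Sel^(2)(E/ℚ) · #ker g_k < 2^{2^k}` — the seed's own `2`-descent over `ℚ`
bounds the layer at which the door can open. [cite: GreenbergLNM1716, §3 Lemmas 3.1–3.4] [cite: SilvermanAEC2009, Thm. X.4.2] -/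
theorem oneLayer_floor (ht : ∀ x : ℚ, ¬ HasRationalTwoTorsionX W x) (κ : ZpExtension ℚ 2) {k : ℕ}
    (hlt : Nat.card ((W.baseChange (κ.layer k)).selmerGroup 2) * Nat.card (W.KerG κ k) < 2 ^ (2 ^ k)) :
    Nat.card (W.selmerGroup 2) * Nat.card (W.KerG κ k) < 2 ^ (2 ^ k) :=
  lt_of_le_of_lt (Nat.mul_le_mul_right _ (natCard_selmerGroup_two_le_layer W ht κ k)) hlt

omit [W.IsGloballyMinimal] in
/-- **Floor of the one-layer door in rank `0`**: `#Ш(E/ℚ)[2] · #ker g_k < 2^{2^k}` is necessary. [cite: GreenbergLNM1716, §3 Lemmas 3.1–3.4]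
[cite: SilvermanAEC2009, Thm. X.4.2] -/
theorem oneLayer_floor_sha (ht : ∀ x : ℚ, ¬ HasRationalTwoTorsionX W x) (hr : W.mordellWeilRank = 0) (κ : ZpExtension ℚ 2)
    {k : ℕ} (hlt : Nat.card ((W.baseChange (κ.layer k)).selmerGroup 2) * Nat.card (W.KerG κ k) < 2 ^ (2 ^ k)) :
    Nat.card ((↥W.sha)[(2 : ℤ)]) * Nat.card (W.KerG κ k) < 2 ^ (2 ^ k) :=
  lt_of_le_of_lt (Nat.mul_le_mul_right _ (natCard_sha_two_le_layer W ht hr κ k)) hlt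

omit [W.IsGloballyMinimal] in
/-- **Floor of the BASE-PAIR door** (`…MuDoorDescentBase.seedMuZero_of_descent_baseJump_two`): if
`#Sel^(2)(E/ℚ_k) · #ker g_k · 2 < #Sel^(2)(E/ℚ) · 2^{2^k}` then, since `#Sel^(2)(E/ℚ) ≤ #Sel^(2)(E/ℚ_k)`, necessarily
`#ker g_k · 2 < 2^{2^k}` — the two Selmer counts cancel; the door is a statement about the local defect alone plus «no growth».
[cite: GreenbergLNM1716, §3 Lemmas 3.1–3.4] [cite: SilvermanAEC2009, Thm. X.4.2] -/
theorem basePair_floor (ht : ∀ x : ℚ, ¬ HasRationalTwoTorsionX W x) (κ : ZpExtension ℚ 2) {k : ℕ}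
    (hlt : Nat.card ((W.baseChange (κ.layer k)).selmerGroup 2) * Nat.card (W.KerG κ k) * 2 <
      Nat.card (W.selmerGroup 2) * 2 ^ (2 ^ k)) :
    Nat.card (W.KerG κ k) * 2 < 2 ^ (2 ^ k) := by
  have hmono := natCard_selmerGroup_two_le_layer W ht κ k
  have h : Nat.card ((W.baseChange (κ.layer k)).selmerGroup 2) * (Nat.card (W.KerG κ k) * 2) <
      Nat.card ((W.baseChange (κ.layer k)).selmerGroup 2) * 2 ^ (2 ^ k) :=
    calc Nat.card ((W.baseChange (κ.layer k)).selmerGroup 2) * (Nat.card (W.KerG κ k) * 2)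
        = Nat.card ((W.baseChange (κ.layer k)).selmerGroup 2) * Nat.card (W.KerG κ k) * 2 := by ring
      _ < Nat.card (W.selmerGroup 2) * 2 ^ (2 ^ k) := hlt
      _ ≤ Nat.card ((W.baseChange (κ.layer k)).selmerGroup 2) * 2 ^ (2 ^ k) := Nat.mul_le_mul_right _ hmono
  exact Nat.lt_of_mul_lt_mul_left h

omit [W.IsGloballyMinimal] in
/-- **Floor of the TWO-LAYER door** (`…MuDoorDescent.seedMuZero_of_descent_rankJump_two`): if
`#Sel^(2)(E/ℚ_k) · #ker g_k · 2^{2^j} < #Sel^(2)(E/ℚ_j) · 2^{2^k}` at `j ≤ k` then `#ker g_k · 2^{2^j} < 2^{2^k}` — the descent ranks only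
grow (`d_j ≤ d_k`), so in logarithms the door `d_k − d_j + log₂ #ker g_k < 2^k − 2^j` needs `log₂ #ker g_k < 2^k − 2^j`.
[cite: GreenbergLNM1716, §3 Lemmas 3.1–3.4] [cite: SilvermanAEC2009, Thm. X.4.2] -/
theorem twoLayer_floor (ht : ∀ x : ℚ, ¬ HasRationalTwoTorsionX W x) (κ : ZpExtension ℚ 2) {j k : ℕ} (hjk : j ≤ k)
    (hlt : Nat.card ((W.baseChange (κ.layer k)).selmerGroup 2) * Nat.card (W.KerG κ k) * 2 ^ (2 ^ j) <
      Nat.card ((W.baseChange (κ.layer j)).selmerGroup 2) * 2 ^ (2 ^ k)) :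
    Nat.card (W.KerG κ k) * 2 ^ (2 ^ j) < 2 ^ (2 ^ k) := by
  have hmono := natCard_selmerGroup_two_layer_mono W ht κ hjk
  have h : Nat.card ((W.baseChange (κ.layer k)).selmerGroup 2) * (Nat.card (W.KerG κ k) * 2 ^ (2 ^ j)) <
      Nat.card ((W.baseChange (κ.layer k)).selmerGroup 2) * 2 ^ (2 ^ k) :=
    calc Nat.card ((W.baseChange (κ.layer k)).selmerGroup 2) * (Nat.card (W.KerG κ k) * 2 ^ (2 ^ j))
        = Nat.card ((W.baseChange (κ.layer k)).selmerGroup 2) * Nat.card (W.KerG κ k) * 2 ^ (2 ^ j) := by ring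
      _ < Nat.card ((W.baseChange (κ.layer j)).selmerGroup 2) * 2 ^ (2 ^ k) := hlt
      _ ≤ Nat.card ((W.baseChange (κ.layer k)).selmerGroup 2) * 2 ^ (2 ^ k) := Nat.mul_le_mul_right _ hmono
  exact Nat.lt_of_mul_lt_mul_left h

omit [W.IsGloballyMinimal] in
/-- The two-layer floor in exponent form: `#ker g_k < 2^{2^k − 2^j}`. [cite: GreenbergLNM1716, §3 Lemmas 3.1–3.4] -/
theorem twoLayer_floor' (ht : ∀ x : ℚ, ¬ HasRationalTwoTorsionX W x) (κ : ZpExtension ℚ 2) {j k : ℕ} (hjk : j ≤ k)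
    (hlt : Nat.card ((W.baseChange (κ.layer k)).selmerGroup 2) * Nat.card (W.KerG κ k) * 2 ^ (2 ^ j) <
      Nat.card ((W.baseChange (κ.layer j)).selmerGroup 2) * 2 ^ (2 ^ k)) :
    Nat.card (W.KerG κ k) < 2 ^ (2 ^ k - 2 ^ j) := by
  have h := twoLayer_floor W ht κ hjk hlt
  have hpow : 2 ^ (2 ^ k) = 2 ^ (2 ^ k - 2 ^ j) * 2 ^ (2 ^ j) := by
    rw [← pow_add, Nat.sub_add_cancel (Nat.pow_le_pow_right two_pos hjk)]
  rw [hpow] at h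
  exact Nat.lt_of_mul_lt_mul_right h

/-! ## §4 The floor of the TOWER certificate `towerGapAtTwo_of_descent_cert` -/

omit [W.IsElliptic] in
/-- Bookkeeping: under the certificate's branch hypothesis `hC` every local constant is `≥ 1`, so the product
`∏_{ℓ ∈ P} C_ℓ^{2^{min(j′, e_ℓ)}}` is `≥ 1`. [cite: GreenbergLNM1716, §3 Lemmas 3.3–3.5] -/
theorem one_le_prod_localConst {j' : ℕ} (P : Finset ℕ) (hP : ∀ ℓ ∈ P, ℓ.Prime ∧ ℓ ≠ 2) (C e k : ℕ → ℕ)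
    (hC : ∀ (ℓ : ℕ) [Fact ℓ.Prime], ℓ ∈ P →
      4 ≤ C ℓ ∨ (W.HasMultiplicativeReductionAtPrime ℓ ∧ 2 ≤ C ℓ) ∨
        (W.HasMultiplicativeReductionAtPrime ℓ ∧ (ℓ : ℤ) ^ k ℓ ∣ W.minimalDiscriminantInt ∧
          ¬ (ℓ : ℤ) ^ (k ℓ + 1) ∣ W.minimalDiscriminantInt ∧ ¬ 2 ∣ k ℓ ∧ 1 ≤ C ℓ) ∨
        (¬ (ℓ : ℤ) ∣ W.minimalDiscriminantInt ∧ 1 ≤ C ℓ)) :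
    1 ≤ ∏ ℓ ∈ P, C ℓ ^ 2 ^ min j' (e ℓ) := by
  refine Nat.one_le_iff_ne_zero.mpr (Finset.prod_ne_zero_iff.mpr fun ℓ hℓ ↦ ?_)
  haveI : Fact ℓ.Prime := ⟨(hP ℓ hℓ).1⟩
  have h1 : 1 ≤ C ℓ := by
    rcases hC ℓ hℓ with h | ⟨-, h⟩ | ⟨-, -, -, -, h⟩ | ⟨-, h⟩ <;> omega
  exact pow_ne_zero _ (by omega)

/-- ★★ **THE FLOOR OF THE TOWER CERTIFICATE.** Take the hypotheses of `…DescentTowerCert.towerGapAtTwo_of_descent_cert` at ONE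
cyclotomic presentation `κ` (verbatim shapes: `hlow : 2^a ≤ #Sel^(2)(E/ℚ_j)`, `hup : #Sel^(2)(E/ℚ_{j′}) ≤ 2^d`, the local constants with
their branch condition `hC`, and `harith : 2^d · 4 · ∏ C_ℓ^{2^{min(j′,e_ℓ)}} < 2^{2^{j′} − 2^j + a}`). Monotonicity `#Sel^(2)(E/ℚ_j) ≤
#Sel^(2)(E/ℚ_{j′})` forces **`a ≤ d`**, hence **`4 · ∏ C_ℓ^{…} < 2^{2^{j′} − 2^j}`**, hence **`j′ ≥ 2`** (no certificate from a
`2`-descent over `ℚ` or `ℚ(√2)` alone), **`(j, j′) ≠ (1, 2)`**, and **at `j′ = 2` (`ℚ(ζ₁₆)⁺`): `j = 0`, `∏ = 1` and `d = a`** — the one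
kit count over `ℚ(ζ₁₆)⁺` must show NO `2`-Selmer growth from `ℚ`, and every odd bad prime must sit in a `C_ℓ = 1` branch. Nothing
here certifies `μ₂ = 0`; it prices the certificate before it is computed. [cite: GreenbergLNM1716, §3 Lemmas 3.1–3.5, §4]
[cite: SilvermanAEC2009, Thm. X.4.2] [cite: Washington1997, §13.1] -/
theorem descent_cert_floor (ht : ∀ x : ℚ, ¬ HasRationalTwoTorsionX W x) (κ : ZpExtension ℚ 2) {j j' a d : ℕ} (hjj' : j ≤ j')
    (P : Finset ℕ) (hP : ∀ ℓ ∈ P, ℓ.Prime ∧ ℓ ≠ 2) (C e k : ℕ → ℕ)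
    (hC : ∀ (ℓ : ℕ) [Fact ℓ.Prime], ℓ ∈ P →
      4 ≤ C ℓ ∨ (W.HasMultiplicativeReductionAtPrime ℓ ∧ 2 ≤ C ℓ) ∨
        (W.HasMultiplicativeReductionAtPrime ℓ ∧ (ℓ : ℤ) ^ k ℓ ∣ W.minimalDiscriminantInt ∧
          ¬ (ℓ : ℤ) ^ (k ℓ + 1) ∣ W.minimalDiscriminantInt ∧ ¬ 2 ∣ k ℓ ∧ 1 ≤ C ℓ) ∨
        (¬ (ℓ : ℤ) ∣ W.minimalDiscriminantInt ∧ 1 ≤ C ℓ))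
    (hlow : 2 ^ a ≤ Nat.card ((W.baseChange (κ.layer j)).selmerGroup 2))
    (hup : Nat.card ((W.baseChange (κ.layer j')).selmerGroup 2) ≤ 2 ^ d)
    (harith : 2 ^ d * 4 * ∏ ℓ ∈ P, C ℓ ^ 2 ^ min j' (e ℓ) < 2 ^ (2 ^ j' - 2 ^ j + a)) :
    a ≤ d ∧ 4 * ∏ ℓ ∈ P, C ℓ ^ 2 ^ min j' (e ℓ) < 2 ^ (2 ^ j' - 2 ^ j) ∧ 2 ≤ j' ∧ ¬ (j = 1 ∧ j' = 2) ∧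
      (j' = 2 → j = 0 ∧ ∏ ℓ ∈ P, C ℓ ^ 2 ^ min j' (e ℓ) = 1 ∧ d = a) := by
  set Pr := ∏ ℓ ∈ P, C ℓ ^ 2 ^ min j' (e ℓ) with hPr
  have hPr1 : 1 ≤ Pr := one_le_prod_localConst W P hP C e k hC
  -- (1) `a ≤ d` by monotonicity
  have had' : 2 ^ a ≤ 2 ^ d := hlow.trans ((natCard_selmerGroup_two_layer_mono W ht κ hjj').trans hup)
  have had : a ≤ d := (Nat.pow_le_pow_iff_right (by norm_num : 1 < 2)).mp had'
  -- (2) cancel `2^a ≤ 2^d`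
  have hX : 4 * Pr < 2 ^ (2 ^ j' - 2 ^ j) := by
    have h1 : 2 ^ d * (4 * Pr) < 2 ^ d * 2 ^ (2 ^ j' - 2 ^ j) :=
      calc 2 ^ d * (4 * Pr) = 2 ^ d * 4 * Pr := by ring
        _ < 2 ^ (2 ^ j' - 2 ^ j + a) := harith
        _ = 2 ^ (2 ^ j' - 2 ^ j) * 2 ^ a := by rw [pow_add]
        _ ≤ 2 ^ (2 ^ j' - 2 ^ j) * 2 ^ d := Nat.mul_le_mul_left _ had'
        _ = 2 ^ d * 2 ^ (2 ^ j' - 2 ^ j) := by ring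
    exact Nat.lt_of_mul_lt_mul_left h1
  -- (3) the exponent is at least `3`
  have hexp : 3 ≤ 2 ^ j' - 2 ^ j := by
    by_contra hlt
    have hle : 2 ^ (2 ^ j' - 2 ^ j) ≤ 2 ^ 2 := Nat.pow_le_pow_right two_pos (by omega)
    omega
  have hjle : 2 ^ j ≤ 2 ^ j' := Nat.pow_le_pow_right two_pos hjj'
  -- (4) `j' ≥ 2`
  have hj' : 2 ≤ j' := by
    by_contra h
    have : 2 ^ j' ≤ 2 ^ 1 := Nat.pow_le_pow_right two_pos (by omega)
    have h1j : 1 ≤ 2 ^ j := Nat.one_le_two_pow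
    omega
  refine ⟨had, hX, hj', fun ⟨h1, h2⟩ ↦ ?_, fun h2 ↦ ?_⟩
  · subst h1; subst h2; norm_num at hexp
  · subst h2
    have hj0 : j = 0 := by
      rcases Nat.lt_or_ge j 1 with h | h
      · omega
      · have : 2 ^ 1 ≤ 2 ^ j := Nat.pow_le_pow_right two_pos h
        norm_num at hexp; omega
    subst hj0
    have hPreq : Pr = 1 := by
      norm_num at hX
      omega
    refine ⟨rfl, hPreq, le_antisymm ?_ had⟩
    -- `2^d · 4 · 1 < 2^(3 + a)` gives `d ≤ a`
    have h3 : 2 ^ d * 4 * Pr < 2 ^ (2 ^ 2 - 2 ^ 0 + a) := harith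
    rw [hPreq, mul_one, show 2 ^ 2 - 2 ^ 0 + a = a + 3 by norm_num; omega, pow_add] at h3
    have h4 : 2 ^ d * 4 < 2 ^ a * 8 := by simpa using h3
    have h5 : 2 ^ d < 2 ^ (a + 1) := by rw [pow_succ]; omega
    have := (Nat.pow_lt_pow_iff_right (by norm_num : 1 < 2)).mp h5
    omega

/-- ★★ **THE FLOOR OF THE CERTIFICATE ON A Ш-NONTRIVIAL SEED.** Hypotheses of
`…DescentTowerCert.towerGapAtTwo_of_descent_cert_of_shaAn_even` at ONE cyclotomic presentation `κ` (`BSD₂(W)`, `r_an = 0`, `#Ш_an = q`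
with `ord₂ q ≠ 0`, the local constants with `hC`, ONE kit count `hup : #Sel^(2)(E/ℚ_{j′}) ≤ 2^d`, `harith : 2^d · 4 · ∏ < 2^{2^{j′}+1}`).
Since `4 ≤ #Ш(E/ℚ)[2] ≤ #Sel^(2)(E/ℚ_{j′}) ≤ 2^d`: **`d ≥ 2`, `j′ ≥ 2`, `2^d · ∏ < 2^{2^{j′} − 1}`; at `j′ = 2` (`ℚ(ζ₁₆)⁺`) exactly `d = 2`
(the count over `ℚ(ζ₁₆)⁺` must EQUAL the base `#Ш(E/ℚ)[2] = 4`: no growth, `Ш(E/ℚ)[2] = (ℤ/2)²`) and `∏ = 1`; at `j′ = 3` (`ℚ(ζ₃₂)⁺`,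
degree `8`) `2^d · ∏ < 128`.** This is where the CENSUS ASK's one `2`-descent has to be pointed. [cite: GreenbergLNM1716, §3 Lemmas 3.1–3.5, §4]
[cite: Cassels1962ArithmeticIV, Thm. 1.1] [cite: Miller2011LMS, Def. 1.1] [cite: SilvermanAEC2009, Thm. X.4.2] -/
theorem descent_cert_floor_of_shaAn_even (ht : ∀ x : ℚ, ¬ HasRationalTwoTorsionX W x)
    (hbsd : BSDp W 2) (hr : W.analyticRank = 0) {q : ℚ} (hq : shaAn W = (q : ℂ)) (hv : padicValRat 2 q ≠ 0)
    (κ : ZpExtension ℚ 2) {j' d : ℕ} (P : Finset ℕ) (hP : ∀ ℓ ∈ P, ℓ.Prime ∧ ℓ ≠ 2) (C e k : ℕ → ℕ)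
    (hC : ∀ (ℓ : ℕ) [Fact ℓ.Prime], ℓ ∈ P →
      4 ≤ C ℓ ∨ (W.HasMultiplicativeReductionAtPrime ℓ ∧ 2 ≤ C ℓ) ∨
        (W.HasMultiplicativeReductionAtPrime ℓ ∧ (ℓ : ℤ) ^ k ℓ ∣ W.minimalDiscriminantInt ∧
          ¬ (ℓ : ℤ) ^ (k ℓ + 1) ∣ W.minimalDiscriminantInt ∧ ¬ 2 ∣ k ℓ ∧ 1 ≤ C ℓ) ∨
        (¬ (ℓ : ℤ) ∣ W.minimalDiscriminantInt ∧ 1 ≤ C ℓ))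
    (hup : Nat.card ((W.baseChange (κ.layer j')).selmerGroup 2) ≤ 2 ^ d)
    (harith : 2 ^ d * 4 * ∏ ℓ ∈ P, C ℓ ^ 2 ^ min j' (e ℓ) < 2 ^ (2 ^ j' + 1)) :
    2 ≤ d ∧ 2 ≤ j' ∧ 2 ^ d * ∏ ℓ ∈ P, C ℓ ^ 2 ^ min j' (e ℓ) < 2 ^ (2 ^ j' - 1) ∧
      (j' = 2 → d = 2 ∧ ∏ ℓ ∈ P, C ℓ ^ 2 ^ min j' (e ℓ) = 1) ∧
      (j' = 3 → 2 ^ d * ∏ ℓ ∈ P, C ℓ ^ 2 ^ min j' (e ℓ) < 128) := by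
  set Pr := ∏ ℓ ∈ P, C ℓ ^ 2 ^ min j' (e ℓ) with hPr
  have hPr1 : 1 ≤ Pr := one_le_prod_localConst W P hP C e k hC
  have hr0 : W.mordellWeilRank = 0 := mordellWeilRank_eq_zero_of_bsdp W hbsd hr
  have h4 : 4 ≤ Nat.card ((↥W.sha)[(2 : ℤ)]) := by exact_mod_cast four_le_natCard_sha_torsionBy_two_of_bsdp W hbsd hq hv
  -- (1) `d ≥ 2`
  have h2d' : 2 ^ 2 ≤ 2 ^ d := by
    have := (h4.trans (natCard_sha_two_le_layer W ht hr0 κ j')).trans hup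
    simpa using this
  have h2d : 2 ≤ d := (Nat.pow_le_pow_iff_right (by norm_num : 1 < 2)).mp h2d'
  -- (2) `2^d · Pr < 2^(2^j' - 1)`
  have h1j : 1 ≤ 2 ^ j' := Nat.one_le_two_pow
  have hX : 2 ^ d * Pr < 2 ^ (2 ^ j' - 1) := by
    have h1 : 4 * (2 ^ d * Pr) < 4 * 2 ^ (2 ^ j' - 1) :=
      calc 4 * (2 ^ d * Pr) = 2 ^ d * 4 * Pr := by ring
        _ < 2 ^ (2 ^ j' + 1) := harith
        _ = 4 * 2 ^ (2 ^ j' - 1) := by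
          rw [show 2 ^ j' + 1 = 2 + (2 ^ j' - 1) by omega, pow_add]; norm_num
    exact Nat.lt_of_mul_lt_mul_left h1
  -- (3) `j' ≥ 2`
  have hj' : 2 ≤ j' := by
    by_contra h
    have hle : 2 ^ (2 ^ j' - 1) ≤ 2 ^ 1 := by
      apply Nat.pow_le_pow_right two_pos
      have : 2 ^ j' ≤ 2 ^ 1 := Nat.pow_le_pow_right two_pos (by omega)
      omega
    have : 2 ^ 2 * 1 ≤ 2 ^ d * Pr := Nat.mul_le_mul h2d' hPr1
    omega
  refine ⟨h2d, hj', hX, fun h2 ↦ ?_, fun h3 ↦ ?_⟩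
  · subst h2
    have hX' : 2 ^ d * Pr < 8 := by simpa using hX
    have h16 : 4 * Pr ≤ 2 ^ d * Pr := Nat.mul_le_mul_right _ (by simpa using h2d')
    have hPreq : Pr = 1 := by omega
    refine ⟨le_antisymm ?_ h2d, hPreq⟩
    rw [hPreq, mul_one] at hX'
    have h5 : 2 ^ d < 2 ^ 3 := by simpa using hX'
    have := (Nat.pow_lt_pow_iff_right (by norm_num : 1 < 2)).mp h5
    omega
  · subst h3
    simpa using hX

end Cell

end Summit.BirchSwinnertonDyer.BirchSwinnertonDyer.Theorems.AlignedTransportAtTwoSelmerLayerDescentMonotone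

end
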